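import Summits.QuantumFields.BalabanUV.T4Continuum.Support.NE7K1LinStripClassCauchy

/-!
# NE7K1LinStripClassSums — row NE7 (node U5), candidate route HOM, path H1L, cell K1-lin(s): NEEDS-ESTIMATE #E1, R-E1 TRANCHE C —
# b04's `B4StripSums` §3–§6 RE-TYPED OVER THE CLASS `S`: the regrouped (2.48) multiplier `GS n σ a τ = Σ_k F_k·RS_k∕ES` of
# `(σ + aQ*Q)⁻¹Q*`, its `n`-uniform bound, holomorphy and side periodicity on the zero-free strip, `StripRegular`, and THE EXPONENTIAL
# DECAY OF ITS LATTICE KERNEL with constants in `(d, a₋, a₊, r, C_up)` ONLY (b04's contour-shift engine BY NAME)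

Lineage `b2b-balaban-t4-ne7-p2` (CRUX PROVER NE7 #2), generation 76; file 67.  Files 62–63 gave the class `SymbS n σ r C_S C_up`, the
regrouped denominator `ES n σ a` with the shifted floors `Re σ(q+2πk) ≥ ¼W_n(k)`, edge positivity, the uniform zero-free strip
`cS ≤ ‖ES‖` on `Strip d κ_S`, and the shift law `ES_tr`.  THIS FILE ([folklore]; b04's `F`, `norm_F_le`, `W`, `inv_W_le_prod_rpow`,
`sum_prod_le`, `F_tr`, `tr_mem_Strip`, `differentiableAt_F` and pv17's `latticeKernel_decay` BY NAME — the averaging weights, the residue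
sums and the contour shift are the symbol-independent half of the engine):

* §1 **`RS n σ k`** `= σ(p)∕σ(p + 2πk)` (`k ≠ 0`; `1` at `k = 0`), **`termS`** `= F·RS∕ES`, **`GS n σ a τ`** `= Σ_k termS` — b04's `R`,
  `term`, `G` with `Δ^ξ_n + m² ↦ σ`; `R_eq_RS ∕ term_eq_termS ∕ G_eq_GS` (`rfl`): b04's multiplier IS the class multiplier at the
  block Laplacian; the dictionary `RS_div_ES_eq_printed` (`RS∕ES = 1∕[σ(p+2πk)·B_σ(p)]`, the printed denominator of (2.48) over `σ`).
* §2 the `n`-UNIFORM BOUND on the fat region where `c ≤ ‖ES‖`: `‖RS_k‖ ≤ 4C_up∕W_n(k)` (the class floor `¼W ≤ Re σ(q+2πk)`),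
  `‖RS_k‖ ≤ CRS(C_up)·Π_ν ω^{−2∕d}`, `‖termS‖ ≤ c⁻¹CRS·Π_ν 24ω^{−(1+2∕d)}`, **`norm_GS_le`**: `‖GS‖ ≤ boundGS d c C_up = c⁻¹·CRS·(48ζ_d)^d`.
* §3 joint holomorphy `differentiableAt_RS ∕ _termS ∕ _GS` on the fat region where `ES ≠ 0`.
* §4 SIDE PERIODICITY `termS_tr_side ∕ GS_tr_side` at strip points with `Re p_μ = −π` (file 62's edge positivity makes `σ ≠ 0` at both
  side points, file 63's `ES_tr` + b04's `F_tr` relabel the residues by `σ_μ`).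
* §5 **`stripRegular_GS`** (any zero-free strip of `ES` inside `|Im| ≤ r`) and, on the class strip of file 63, **`GS_stripRegular`**:
  `StripRegular (GS n σ a τ) (κ_S(d+1, a₋, a₊, C_up, r)) (boundGS (d+1) (cS (d+1) a₋) C_up)` for EVERY `σ ∈ S`, `a ∈ [a₋, a₊]`, `τ`;
  **`kernelS_decay`**: `‖latticeKernel (GS n σ a τ) x‖ ≤ boundGS·e^{−κ_S·|x|_∞}` for every `x ∈ ℤ^{d+1}` — B4 (2.35), first quantity, for
  `(σ + aQ*Q)⁻¹Q*` with `σ` ANY member of the class, constants seeing `σ` only through `(r, C_up)`.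

The line and NN corollaries and the finite-torus periodisation (pv17's `B4TorusKernel.MultiPeriod` BY NAME) are file 68.

HONEST FRAMING: [folklore] — b04's proof of the audit's regrouped (2.48)∕(2.51) bookkeeping with one symbol letter generalised; the kernel
statement is about the MULTIPLIER's lattice Fourier transform (the operator-level identity «this multiplier is the kernel of
`(σ + aQ*Q)⁻¹Q*`» is, as in b04's `B4Torus248Decay` (ii), not re-derived here); nothing of Bałaban's asserted; no `sorry`.  Census only;
NE7 NOT PRINTED ∕ NOT PROVED; spine 0∕9; FIXED FINITE T⁴, rung (B)+1; NOT infinite volume, NOT mass gap, NOT Clay.  HONEST DEPENDENCY: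
continuum YM on T⁴ ⇐ BetaPertH ∧ nine spine estimates (0/9 proved); BetaPertH ⇐ (D1) ∧ (D4) ∧ CAP+tail; G-an2-4 gates asym, D1 and NE2/3/4.
-/

noncomputable section

open Finset Complex Set

namespace Summit.QuantumFields.BalabanUV.T4Continuum.NE7K1LinStripClassSums

open Literature.MathematicalPhysics.QuantumFieldTheory.Balaban1983to89
open Literature.MathematicalPhysics.QuantumFieldTheory.Balaban1983to89.B4Strip
open Literature.MathematicalPhysics.QuantumFieldTheory.Balaban1983to89.B4StripCauchy
open Literature.MathematicalPhysics.QuantumFieldTheory.Balaban1983to89.B4StripSums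
open Literature.MathematicalPhysics.QuantumFieldTheory.Balaban1983to89.B5Strip145Analytic
open Literature.MathematicalPhysics.QuantumFieldTheory.Balaban1983to89.B5Strip145Decay
open Literature.MathematicalPhysics.QuantumFieldTheory.Balaban1983to89.B4ContourShift
open NE7K1LinStripClass NE7K1LinStripClassCauchy

variable {d : ℕ}

/-! ### §1 The regrouped multiplier over the class -/

/-- `RS_k(p) = 1` (`k = 0`), `= σ(p)∕σ(p + 2πk)` (`k ≠ 0`) — b04's regrouped ratio `R` over a general symbol.
[cite: Balaban1983RegularityDecay, (2.48) p.585 (regrouped by the audit; symbol generalised)] -/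
def RS (n : ℕ) [NeZero n] (σ : (Fin d → ℂ) → ℂ) (k : Fin d → Fin n) (p : Fin d → ℂ) : ℂ :=
  if k = fun _ => (0 : Fin n) then 1 else σ p / σ (shift n k p)

/-- one term of the `l`-sum of (2.48) over the class: `F·RS∕ES`. [cite: Balaban1983RegularityDecay, (2.48) p.585 (regrouped by the audit; symbol generalised)] -/
def termS (n : ℕ) [NeZero n] (σ : (Fin d → ℂ) → ℂ) (a : ℝ) (τ k : Fin d → Fin n) (p : Fin d → ℂ) : ℂ :=
  F n τ k p * RS n σ k p / ES n σ a p

/-- THE FOURIER MULTIPLIER OF `(σ + aQ*Q)⁻¹Q*` AT BLOCK OFFSET `τ`: `GS(p′) = Σ_k F_k(p′)·RS_k(p′)∕ES(p′)` — b04's `G` over the class.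
[cite: Balaban1983RegularityDecay, (2.48) p.585 (regrouped by the audit; symbol generalised)] -/
def GS (n : ℕ) [NeZero n] (σ : (Fin d → ℂ) → ℂ) (a : ℝ) (τ : Fin d → Fin n) (p : Fin d → ℂ) : ℂ :=
  ∑ k : Fin d → Fin n, termS n σ a τ k p

/-- b04's ratio IS the class ratio at the block Laplacian. [folklore] -/
theorem R_eq_RS (n : ℕ) [NeZero n] (m2 : ℝ) (k : Fin d → Fin n) (p : Fin d → ℂ) : R n m2 k p = RS n (DeltaXi n m2) k p := rfl

/-- b04's term IS the class term at the block Laplacian. [folklore] -/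
theorem term_eq_termS (n : ℕ) [NeZero n] (a m2 : ℝ) (τ k : Fin d → Fin n) (p : Fin d → ℂ) :
    term n a m2 τ k p = termS n (DeltaXi n m2) a τ k p := rfl

/-- b04's multiplier IS the class multiplier at the block Laplacian: `G n a m² τ = GS n (Δ^ξ_n + m²) a τ`. [folklore] -/
theorem G_eq_GS (n : ℕ) [NeZero n] (a m2 : ℝ) (τ : Fin d → Fin n) (p : Fin d → ℂ) :
    G n a m2 τ p = GS n (DeltaXi n m2) a τ p := rfl

/-- `RS_k = σ(p)∕σ(p + 2πk)` for every `k` wherever `σ(p) ≠ 0`. [folklore] -/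
theorem RS_eq_div (n : ℕ) [NeZero n] (σ : (Fin d → ℂ) → ℂ) (k : Fin d → Fin n) (p : Fin d → ℂ) (h0 : σ p ≠ 0) :
    RS n σ k p = σ p / σ (shift n k p) := by
  unfold RS
  split_ifs with h
  · rw [h, shift_zero, div_self h0]
  · rfl

/-- THE DICTIONARY WITH (2.48) over the class: `RS_k∕ES = 1∕[σ(p + 2πk)·B_σ(p)]`, `B_σ = 1 + aΣ_l U_l∕σ(· + 2πl)`. [folklore] -/
theorem RS_div_ES_eq_printed (n : ℕ) [NeZero n] (σ : (Fin d → ℂ) → ℂ) (a : ℝ) (k : Fin d → Fin n) (p : Fin d → ℂ)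
    (h0 : σ p ≠ 0) (hk : σ (shift n k p) ≠ 0) (hB : BfacS n σ a p ≠ 0) :
    RS n σ k p / ES n σ a p = 1 / (σ (shift n k p) * BfacS n σ a p) := by
  rw [RS_eq_div n σ k p h0, ES_eq_mul_BfacS n σ a p h0]
  field_simp

variable {n : ℕ} {σ : (Fin d → ℂ) → ℂ} {r CS Cup : ℝ}

/-! ### §2 The `n`-uniform bound on the fat region -/

/-- the constant of the `RS`-bound: `CRS = 4C_up + 1`. [folklore] -/
def CRS (Cup : ℝ) : ℝ := 4 * Cup + 1

/-- `CRS ≥ 0` for `C_up ≥ 0`. [folklore] -/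
theorem CRS_nonneg {Cup : ℝ} (hC : 0 ≤ Cup) : 0 ≤ CRS Cup := by unfold CRS; positivity

/-- `‖RS_k‖ ≤ 4C_up∕W_n(k)` on the fat region, `k ≠ 0` (the class floor `¼W ≤ Re σ(q+2πk)` in the denominator). [folklore] -/
theorem norm_RS_le [NeZero n] (h : SymbS n σ r CS Cup) {q : Fin d → ℂ} (hq : q ∈ Fat d r) (k : Fin d → Fin n)
    (hk : k ≠ fun _ => 0) : ‖RS n σ k q‖ ≤ 4 * Cup / W n k := by
  unfold RS
  rw [if_neg hk, norm_div]
  have hW1 := one_le_W n k hk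
  have hden : 1 / 4 * W n k ≤ ‖σ (shift n k q)‖ := (h.W_le_re_shift hq k hk).trans (Complex.re_le_norm _)
  have hnum := h.upper q hq
  have hpos : 0 < 1 / 4 * W n k := by linarith
  calc ‖σ q‖ / ‖σ (shift n k q)‖ ≤ Cup / (1 / 4 * W n k) := div_le_div₀ h.cup_nonneg hnum hpos hden
    _ = 4 * Cup / W n k := by field_simp

/-- `‖RS_k‖ ≤ CRS·Π_ν ω_n(k_ν)^{−2∕d}` for EVERY `k` (product form of the quadratic gain). [folklore] -/
theorem norm_RS_le_prod [NeZero n] (h : SymbS n σ r CS Cup) (hd : 0 < d) {q : Fin d → ℂ} (hq : q ∈ Fat d r)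
    (k : Fin d → Fin n) : ‖RS n σ k q‖ ≤ CRS Cup * ∏ ν, omega n (k ν) ^ (-(2 : ℝ) / d) := by
  have hn : 1 ≤ n := Nat.one_le_iff_ne_zero.mpr (NeZero.ne n)
  have hC := h.cup_nonneg
  by_cases hk : k = fun _ => 0
  · have h1 : ‖RS n σ k q‖ = 1 := by unfold RS; rw [if_pos hk, norm_one]
    have h2 : ∏ ν, omega n (k ν) ^ (-(2 : ℝ) / d) = 1 := by
      apply Finset.prod_eq_one
      intro ν _
      rw [hk]
      simp only [Fin.val_zero, omega_zero n hn, Real.one_rpow]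
    rw [h1, h2, mul_one]
    unfold CRS; linarith
  · have h1 := norm_RS_le h hq k hk
    have h2 := inv_W_le_prod_rpow n hd k hk
    have hP0 : 0 ≤ ∏ ν, omega n (k ν) ^ (-(2 : ℝ) / d) :=
      Finset.prod_nonneg (fun ν _ => Real.rpow_nonneg (omega_pos n (k ν) (k ν).isLt).le _)
    calc ‖RS n σ k q‖ ≤ 4 * Cup / W n k := h1
      _ = 4 * Cup * (1 / W n k) := by ring
      _ ≤ 4 * Cup * ∏ ν, omega n (k ν) ^ (-(2 : ℝ) / d) := mul_le_mul_of_nonneg_left h2 (by positivity)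
      _ ≤ CRS Cup * ∏ ν, omega n (k ν) ^ (-(2 : ℝ) / d) := mul_le_mul_of_nonneg_right (by unfold CRS; linarith) hP0

/-- the bound of one term: `‖F·RS∕ES‖ ≤ c⁻¹·CRS·Π_ν 24ω_n(k_ν)^{−(1+2∕d)}` on the fat region where `‖ES‖ ≥ c`. [folklore] -/
theorem norm_termS_le [NeZero n] (h : SymbS n σ r CS Cup) (hd : 0 < d) (a : ℝ) {p : Fin d → ℂ} (hp : p ∈ Fat d r)
    {c : ℝ} (hc : 0 < c) (hE : c ≤ ‖ES n σ a p‖) (τ k : Fin d → Fin n) :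
    ‖termS n σ a τ k p‖ ≤ c⁻¹ * CRS Cup * ∏ ν, 24 * omega n (k ν) ^ (-(1 + 2 / (d : ℝ))) := by
  unfold termS
  rw [norm_div, norm_mul]
  have hF := norm_F_le n h.r_le τ k hp
  have hR := norm_RS_le_prod h hd hp k
  have hE' : ‖ES n σ a p‖⁻¹ ≤ c⁻¹ := inv_anti₀ hc hE
  have hP1 : 0 ≤ ∏ ν, 24 / omega n (k ν) :=
    Finset.prod_nonneg (fun ν _ => div_nonneg (by norm_num) (omega_pos n (k ν) (k ν).isLt).le)
  have hP0 : 0 ≤ ∏ ν, omega n (k ν) ^ (-(2 : ℝ) / d) :=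
    Finset.prod_nonneg (fun ν _ => Real.rpow_nonneg (omega_pos n (k ν) (k ν).isLt).le _)
  have hCR := CRS_nonneg h.cup_nonneg
  have hprod : (∏ ν, 24 / omega n (k ν)) * ∏ ν, omega n (k ν) ^ (-(2 : ℝ) / d)
      = ∏ ν, 24 * omega n (k ν) ^ (-(1 + 2 / (d : ℝ))) := by
    rw [← Finset.prod_mul_distrib]
    refine Finset.prod_congr rfl (fun ν _ => ?_)
    have hω := omega_pos n (k ν) (k ν).isLt
    rw [div_eq_mul_inv, ← Real.rpow_neg_one, mul_assoc, ← Real.rpow_add hω]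
    congr 1
    ring_nf
  calc ‖F n τ k p‖ * ‖RS n σ k p‖ / ‖ES n σ a p‖
      = ‖F n τ k p‖ * ‖RS n σ k p‖ * ‖ES n σ a p‖⁻¹ := div_eq_mul_inv _ _
    _ ≤ ((∏ ν, 24 / omega n (k ν)) * (CRS Cup * ∏ ν, omega n (k ν) ^ (-(2 : ℝ) / d))) * c⁻¹ := by
        apply mul_le_mul (mul_le_mul hF hR (norm_nonneg _) hP1) hE' (inv_nonneg.mpr (norm_nonneg _))
        positivity
    _ = c⁻¹ * CRS Cup * ((∏ ν, 24 / omega n (k ν)) * ∏ ν, omega n (k ν) ^ (-(2 : ℝ) / d)) := by ring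
    _ = c⁻¹ * CRS Cup * ∏ ν, 24 * omega n (k ν) ^ (-(1 + 2 / (d : ℝ))) := by rw [hprod]

/-- the uniform bound `boundGS d c C_up = c⁻¹·CRS(C_up)·(48ζ_d)^d` of the class multiplier. [folklore] -/
def boundGS (d : ℕ) (c Cup : ℝ) : ℝ := c⁻¹ * CRS Cup * (48 * zetaC d) ^ d

/-- `boundGS ≥ 0`. [folklore] -/
theorem boundGS_nonneg (d : ℕ) {c Cup : ℝ} (hc : 0 < c) (hC : 0 ≤ Cup) : 0 ≤ boundGS d c Cup := by
  unfold boundGS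
  have := CRS_nonneg hC
  have := zetaC_nonneg d
  positivity

/-- **THE UNIFORM BOUND OF THE CLASS MULTIPLIER ON THE FAT REGION**: where `‖ES(p′)‖ ≥ c > 0`, `‖GS n σ a τ p′‖ ≤ c⁻¹·CRS·(48ζ_d)^d` —
independent of `n`, `τ`, `a`, and of `σ` beyond `C_up`. [folklore] -/
theorem norm_GS_le [NeZero n] (h : SymbS n σ r CS Cup) (hd : 0 < d) (a : ℝ) {p : Fin d → ℂ} (hp : p ∈ Fat d r)
    {c : ℝ} (hc : 0 < c) (hE : c ≤ ‖ES n σ a p‖) (τ : Fin d → Fin n) : ‖GS n σ a τ p‖ ≤ boundGS d c Cup := by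
  unfold GS boundGS
  have hCR := CRS_nonneg h.cup_nonneg
  have hsum := sum_prod_le n hd (d := d)
  calc ‖∑ k : Fin d → Fin n, termS n σ a τ k p‖ ≤ ∑ k : Fin d → Fin n, ‖termS n σ a τ k p‖ := norm_sum_le _ _
    _ ≤ ∑ k : Fin d → Fin n, c⁻¹ * CRS Cup * ∏ ν, 24 * omega n (k ν) ^ (-(1 + 2 / (d : ℝ))) :=
        Finset.sum_le_sum (fun k _ => norm_termS_le h hd a hp hc hE τ k)
    _ = c⁻¹ * CRS Cup * ∑ k : Fin d → Fin n, ∏ ν, 24 * omega n (k ν) ^ (-(1 + 2 / (d : ℝ))) := by rw [Finset.mul_sum]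
    _ ≤ c⁻¹ * CRS Cup * (48 * zetaC d) ^ d := mul_le_mul_of_nonneg_left hsum (by positivity)

/-! ### §3 Joint holomorphy on the fat region -/

/-- `RS_k` is holomorphic (jointly) at every point of the fat region. [folklore] -/
theorem differentiableAt_RS [NeZero n] (h : SymbS n σ r CS Cup) {q : Fin d → ℂ} (hq : q ∈ Fat d r) (k : Fin d → Fin n) :
    DifferentiableAt ℂ (RS n σ k) q := by
  have him : ∀ ν, |(q ν).im| ≤ 2 * r := fun ν => (hq ν).2
  by_cases hk : k = fun _ => 0
  · have : RS n σ k = fun _ => (1 : ℂ) := by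
      funext p; unfold RS; rw [if_pos hk]
    rw [this]
    exact differentiableAt_const _
  · have : RS n σ k = fun p => σ p / σ (shift n k p) := by
      funext p; unfold RS; rw [if_neg hk]
    rw [this]
    exact dAt_div (h.holo q him) (h.differentiableAt_shift him k) (h.shift_ne_zero hq k hk)

/-- one term is holomorphic (jointly) at every fat point where `ES ≠ 0`. [folklore] -/
theorem differentiableAt_termS [NeZero n] (h : SymbS n σ r CS Cup) (a : ℝ) {q : Fin d → ℂ} (hq : q ∈ Fat d r)
    (hE : ES n σ a q ≠ 0) (τ k : Fin d → Fin n) : DifferentiableAt ℂ (termS n σ a τ k) q := by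
  show DifferentiableAt ℂ (fun p => F n τ k p * RS n σ k p / ES n σ a p) q
  exact dAt_div ((differentiableAt_F n τ k q).mul (differentiableAt_RS h hq k)) (h.differentiableAt_ES a hq) hE

/-- **the class multiplier is holomorphic (jointly) at every fat point where `ES ≠ 0`** — in particular on the class strip. [folklore] -/
theorem differentiableAt_GS [NeZero n] (h : SymbS n σ r CS Cup) (a : ℝ) {q : Fin d → ℂ} (hq : q ∈ Fat d r)
    (hE : ES n σ a q ≠ 0) (τ : Fin d → Fin n) : DifferentiableAt ℂ (GS n σ a τ) q := by
  show DifferentiableAt ℂ (fun p => ∑ k : Fin d → Fin n, termS n σ a τ k p) q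
  apply DifferentiableAt.fun_sum
  intro k _
  exact differentiableAt_termS h a hq hE τ k

/-! ### §4 Periodicity across the sides of the strip -/

/-- **SIDE PERIODICITY OF ONE TERM over the class**: at a strip point `|Im p_ν| ≤ κ ≤ 2r` with `Re p_μ = −π` and `ES ≠ 0` at `p` and at
`p + 2πe_μ`: `termS_k(p + 2πe_μ) = termS_{σ_μ k}(p)` (edge positivity of `σ`, the shift law `ES_tr`, b04's `F_tr`). [folklore] -/
theorem termS_tr_side [NeZero n] (h : SymbS n σ r CS Cup) (a : ℝ) {κ : ℝ} (hκ : κ ≤ 2 * r) {p : Fin d → ℂ}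
    (hp : p ∈ Strip d κ) (μ : Fin d) (hre : (p μ).re = -Real.pi) (hE0 : ES n σ a p ≠ 0) (hE1 : ES n σ a (tr p μ) ≠ 0)
    (τ k : Fin d → Fin n) : termS n σ a τ k (tr p μ) = termS n σ a τ (sigma n μ k) p := by
  have hn : 1 ≤ n := Nat.one_le_iff_ne_zero.mpr (NeZero.ne n)
  have hπ := Real.pi_pos
  have hz : p μ ≠ 0 := by
    intro e; rw [e, Complex.zero_re] at hre; linarith
  have hz' : p μ + 2 * Real.pi ≠ 0 := by
    intro e
    have := congrArg Complex.re e
    rw [← tr_apply_self, tr_re_self, hre, Complex.zero_re] at this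
    linarith
  have hIm : ∀ ν, |(p ν).im| ≤ 2 * r := fun ν => (hp ν).2.trans hκ
  have h0 : σ p ≠ 0 := by
    intro e
    have := h.re_pos_of_edge hn hIm μ (by rw [hre, abs_neg, abs_of_pos hπ])
    rw [e, Complex.zero_re] at this
    linarith
  have h1 : σ (tr p μ) ≠ 0 := by
    intro e
    have := h.re_pos_of_edge hn (q := tr p μ) (fun ν => by rw [tr_im]; exact hIm ν) μ
      (by rw [tr_re_self, hre]; ring_nf; exact abs_of_pos hπ)
    rw [e, Complex.zero_re] at this
    linarith
  have hEtr := ES_tr h a p μ hz hz' h0 h1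
  unfold termS
  rw [F_tr, RS_eq_div n σ k (tr p μ) h1, RS_eq_div n σ (sigma n μ k) p h0, sigma_shift_tr h k p μ]
  by_cases hDS : σ (shift n (sigma n μ k) p) = 0
  · simp [hDS]
  · rw [div_eq_div_iff hE1 hE0]
    field_simp
    linear_combination (-(F n τ (sigma n μ k) p)) * hEtr

/-- **SIDE PERIODICITY OF THE CLASS MULTIPLIER**: `GS(p + 2πe_μ) = GS(p)` at strip points with `Re p_μ = −π` (relabel by `σ_μ`). [folklore] -/
theorem GS_tr_side [NeZero n] (h : SymbS n σ r CS Cup) (a : ℝ) {κ : ℝ} (hκ : κ ≤ 2 * r) {p : Fin d → ℂ}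
    (hp : p ∈ Strip d κ) (μ : Fin d) (hre : (p μ).re = -Real.pi) (hE0 : ES n σ a p ≠ 0) (hE1 : ES n σ a (tr p μ) ≠ 0)
    (τ : Fin d → Fin n) : GS n σ a τ (tr p μ) = GS n σ a τ p := by
  unfold GS
  calc ∑ k : Fin d → Fin n, termS n σ a τ k (tr p μ) = ∑ k : Fin d → Fin n, termS n σ a τ (sigma n μ k) p :=
        Finset.sum_congr rfl (fun k _ => termS_tr_side h a hκ hp μ hre hE0 hE1 τ k)
    _ = ∑ k : Fin d → Fin n, termS n σ a τ k p := Equiv.sum_comp (sigmaEquiv n μ) (fun k => termS n σ a τ k p)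

/-! ### §5 Strip regularity and the exponential decay of the lattice kernel -/

/-- **STRIP REGULARITY OF THE CLASS MULTIPLIER** (pv17's `StripRegular`): on any strip `Strip (d+1) κ`, `0 ≤ κ ≤ r`, on which `‖ES‖ ≥ c > 0`,
`GS n σ a τ` is continuous, slice-holomorphic, periodic across the sides and bounded by `boundGS (d+1) c C_up` — for every `σ ∈ S`,
`a`, `τ`. [folklore] -/
theorem stripRegular_GS {n : ℕ} [NeZero n] {σ : (Fin (d + 1) → ℂ) → ℂ} {r CS Cup : ℝ} (h : SymbS n σ r CS Cup) (a : ℝ)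
    (τ : Fin (d + 1) → Fin n) {κ c : ℝ} (hκ0 : 0 ≤ κ) (hκr : κ ≤ r) (hc : 0 < c)
    (hE : ∀ p ∈ Strip (d + 1) κ, c ≤ ‖ES n σ a p‖) :
    StripRegular (d := d) (GS n σ a τ) κ (boundGS (d + 1) c Cup) := by
  have hfat : Strip (d + 1) κ ⊆ Fat (d + 1) r := strip_subset_fat h.r_pos.le hκr
  have hd : 0 < d + 1 := Nat.succ_pos d
  have hκ2 : κ ≤ 2 * r := by linarith [h.r_pos]
  have hne : ∀ p ∈ Strip (d + 1) κ, ES n σ a p ≠ 0 := by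
    intro p hp e
    have := hE p hp
    rw [e, norm_zero] at this
    linarith
  have hdiffAt : ∀ p ∈ Strip (d + 1) κ, DifferentiableAt ℂ (GS n σ a τ) p := fun p hp =>
    differentiableAt_GS h a (hfat hp) (hne p hp) τ
  refine ⟨?_, ?_, ?_, ?_⟩
  · exact fun p hp => (hdiffAt p hp).continuousAt.continuousWithinAt
  · intro i q hq z hz
    have hP : i.insertNth z (ofRealVec q) ∈ Strip (d + 1) κ :=
      insertNth_mem_Strip hκ0 i hq (openRect_subset_closedRect κ hz)
    exact ((hdiffAt _ hP).comp z (differentiableAt_insertNth i _ z)).differentiableWithinAt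
  · intro i q hq y hy
    obtain ⟨hP, hre⟩ := insertNth_left_mem hκ0 i hq hy
    rw [← tr_insertNth_left]
    have hP' := tr_mem_Strip hP i hre
    exact (GS_tr_side h a hκ2 hP i hre (hne _ hP) (hne _ hP') τ).symm
  · intro p hp
    exact norm_GS_le h hd a (hfat hp) hc (hE p hp) τ

/-- **THE CLASS MULTIPLIER ON THE CLASS STRIP** (file 63's `uniformStrip`): for `0 < a₋ ≤ a ≤ a₊`, every `σ ∈ S(n; r, C_S, C_up)` and every
`τ`: `StripRegular (GS n σ a τ) κ_S(d+1, a₋, a₊, C_up, r) (boundGS (d+1) (cS (d+1) a₋) C_up)` — the data see `σ` only through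
`(r, C_up)`. [folklore] -/
theorem GS_stripRegular {n : ℕ} [NeZero n] {σ : (Fin (d + 1) → ℂ) → ℂ} {r CS Cup : ℝ} (h : SymbS n σ r CS Cup)
    {aminus aplus a : ℝ} (ha : 0 < aminus) (ha1 : aminus ≤ a) (ha2 : a ≤ aplus) (τ : Fin (d + 1) → Fin n) :
    StripRegular (d := d) (GS n σ a τ) (kappaS (d + 1) aminus aplus Cup r) (boundGS (d + 1) (cS (d + 1) aminus) Cup) :=
  stripRegular_GS h a τ (kappaS_pos (d + 1) ha h.cup_nonneg h.r_pos).le (kappaS_le (d + 1) aminus aplus Cup r)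
    (cS_pos (d + 1) ha) (uniformStrip h ha ha1 ha2)

/-- **B4 (2.35), FIRST QUANTITY, OVER THE CLASS — THE EXPONENTIAL DECAY OF THE LATTICE KERNEL OF THE (2.48) MULTIPLIER**: for
`0 < a₋ ≤ a ≤ a₊`, EVERY `n ≥ 1`, EVERY `σ ∈ S(n; r, C_S, C_up)`, every block offset `τ` and every `x ∈ ℤ^{d+1}`:
`‖(2π)^{−(d+1)}∫_{[−π,π]^{d+1}} GS(p′)e^{ip′·x}dp′‖ ≤ boundGS·e^{−κ_S·|x|_∞}` — constants `(κ_S, boundGS)` functions of `(d, a₋, a₊, r, C_up)`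
ALONE (pv17's `latticeKernel_decay` on `GS_stripRegular`). [folklore] -/
theorem kernelS_decay {n : ℕ} [NeZero n] {σ : (Fin (d + 1) → ℂ) → ℂ} {r CS Cup : ℝ} (h : SymbS n σ r CS Cup)
    {aminus aplus a : ℝ} (ha : 0 < aminus) (ha1 : aminus ≤ a) (ha2 : a ≤ aplus) (τ : Fin (d + 1) → Fin n)
    (x : Fin (d + 1) → ℤ) :
    ‖latticeKernel (GS n σ a τ) x‖
      ≤ boundGS (d + 1) (cS (d + 1) aminus) Cup * Real.exp (-(kappaS (d + 1) aminus aplus Cup r * supNorm x)) :=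
  latticeKernel_decay (GS_stripRegular h ha ha1 ha2 τ) (kappaS_pos (d + 1) ha h.cup_nonneg h.r_pos).le x

/-- Euclidean form of the decay (rate `κ_S∕√(d+1)` in `|x|_2`). [folklore] -/
theorem kernelS_decay_euclid {n : ℕ} [NeZero n] {σ : (Fin (d + 1) → ℂ) → ℂ} {r CS Cup : ℝ} (h : SymbS n σ r CS Cup)
    {aminus aplus a : ℝ} (ha : 0 < aminus) (ha1 : aminus ≤ a) (ha2 : a ≤ aplus) (τ : Fin (d + 1) → Fin n)
    (x : Fin (d + 1) → ℤ) :
    ‖latticeKernel (GS n σ a τ) x‖ ≤ boundGS (d + 1) (cS (d + 1) aminus) Cup *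
      Real.exp (-(kappaS (d + 1) aminus aplus Cup r / Real.sqrt (d + 1) * Real.sqrt (∑ i, ((x i : ℝ)) ^ 2))) :=
  latticeKernel_decay_euclid (GS_stripRegular h ha ha1 ha2 τ) (kappaS_pos (d + 1) ha h.cup_nonneg h.r_pos).le
    (boundGS_nonneg _ (cS_pos _ ha) h.cup_nonneg) x

end Summit.QuantumFields.BalabanUV.T4Continuum.NE7K1LinStripClassSums

end
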